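import Summits.NavierStokesRegularity.FunctionalMining.TopEigAmplitudeFloorHolds
import Summits.NavierStokesRegularity.FunctionalMining.TopEigGapCoerciveSimpleAux
import Literature.Analysis.FunctionSpaces.TorusLipschitzGradient
import HarnessLib

/-!
# FunctionalMining / NoGo — K53b: the RATE–VARIANCE RULE (quantitative ISO-TOP)
# `16π²(q−1)/q · (Φ_q(v) − Φ_{q/2}(v)²) ≤ heatDissipation Φ_q v` on `T³`, real `q ≥ 2`

HONEST FRAMING. Search for candidate a priori estimates; no regularity claim. Nothing about
Navier–Stokes is proved or asserted in this file. Cell `pub-nsfunc`, no-go seat (gen 51, touch 2).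
Static calculus of smooth fields on the flat torus.

CONTEXT. Door (b)/(F2) of `NOGO.md` is the WANTED kernel negation `¬ TopEigHeatCoercivePos q` of
the open node Lemma L-λ(q): a KILLING FAMILY of smooth divergence-free fields on `T³` with
`heatDissipation Φ_q v / Φ_q v → 0`, `Φ_q = torusTopEigMoment q = ∫ (λ₁⁺)^q`. The staged K53
(`NoGo/TopEigHeatIsoTop`) shows that an EXACT witness (`heatDissipation Φ_q v ≤ 0`, `q ≥ 2`) has a
CONSTANT top strain eigenvalue `λ₁`. This file is the QUANTITATIVE form of that rigidity, from the
same tree input — the amplitude floor LEMMA AF `topEigAmplitudeFloor_of_two_le`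
(`q(q−1) ∫ λ₁^{q−2} Σᵢ(∂ᵢλ₁)² ≤ heatDissipation Φ_q v`, real `q ≥ 2`) — and the Poincaré inequality
for LIPSCHITZ functions on `T³`, proved here by mollification from the treeʼs smooth scalar
Poincaré inequality `TopEig.four_pi_sq_mul_integral_sq_sub_mean_le`.

CONTENT. § 1 (any `d`): mollification does not increase `∫ ‖∇ζ‖²` for Lipschitz `ζ`
(`∇(ζ ⋆ k_ε)(x) = ∫ k_ε(y) ∇ζ(y + x) dy` by Literature `Torus.gradient_convolution_of_lipschitz`
(Rademacher) and evenness of `k_ε`; then Minkowski–Jensen `lintegral_rpow_enorm_integral_smul_le`).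
§ 2: `4π² ∫ (ζ − ∫ζ)² ≤ ∫ ‖∇ζ‖²` for Lipschitz `ζ : T³ → ℝ`, `∇ζ = Torus.gradient ζ` the junk-valued
(a.e. true) gradient. § 3 (any `d`): a.e. calculus for the Lipschitz `λ₁ = torusStrainTopEig v` at
Rademacher points — `‖∇λ₁‖² = Σᵢ(∂ᵢλ₁)²`, `∇(λ₁^p) = p λ₁^{p−1} ∇λ₁` (`p ≥ 1`), hence
`‖∇(λ₁^{q/2})‖² = (q²/4) λ₁^{q−2} Σᵢ(∂ᵢλ₁)²` (`q ≥ 2`, `div v = 0`); `λ₁^p` is Lipschitz. § 4 (`T³`):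
**`rate_variance_le_heatDissipation`** `16π²(q−1)/q · ∫ (λ₁^{q/2} − ∫λ₁^{q/2})² ≤
heatDissipation Φ_q v` and the moment form **`rate_moments_le_heatDissipation`**
`16π²(q−1)/q · (Φ_q − Φ_{q/2}²) ≤ heatDissipation Φ_q v`, every real `q ≥ 2`, every smooth
divergence-free `v` (`Φ_{q/2}² ≤ Φ_q` by Jensen; the deficit is the variance of `λ₁^{q/2}`). At an
exact witness the left side vanishes: K53ʼs ISO-TOP again.

MEANING FOR (F2) (design rule (R12), records only). FLATTENING: along any killing family for
L-λ(q), `q ≥ 2`, `Φ_{q/2}(v_n)²/Φ_q(v_n) → 1` (`moments_deficit_le`): the normalised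
`λ₁^{q/2}/‖λ₁^{q/2}‖_{L²}` tends to the constant `1` in `L²(T³)` — killing families cannot
concentrate or stay intermittent, they must FILL THE TORUS with an almost constant top strain
eigenvalue, at rate `16π²(q−1)/q`; a design with `limsup Φ_{q/2}²/Φ_q < 1` has
`liminf heatDissipation Φ_q/Φ_q ≥ 16π²(q−1)/q · (1 − limsup Φ_{q/2}²/Φ_q) > 0`. NOT here: `1 < q < 2`
(the floor is kernel for `q ≥ 2` only), `q = 1`, any verdict change — L-λ(q) OPEN for all real
`q > 1`; no 𝒦₀ row, no A12 count, no T_LD input. [ours = §§ 2–4 and the assembly of § 1]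
FILING (prove seat g29, REQUEST #80): declarations byte-identical to the no-go seat's staged `TopEigHeatVariance.STAGING.lean` ed4c2b7b140a4b50; this line is the only addition.
-/

noncomputable section

open MeasureTheory Set Filter Topology Metric Function
open scoped Convolution InnerProductSpace NNReal ENNReal

namespace Summit.NavierStokesRegularity.FunctionalMining

open Literature.Analysis.FunctionSpaces Literature.Analysis.FunctionSpaces.Torus
  Literature.Analysis.FluidPDE

variable {d : Type*} [Fintype d] [DecidableEq d]

namespace TopEig

namespace Variance

/-! ## § 1 Mollification does not increase `∫ ‖∇ζ‖²` (Lipschitz `ζ`, any `d`) -/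

section Mollify

variable {K : ℝ≥0} {ζ : UnitAddTorus d → ℝ}

omit [DecidableEq d] in
/-- `∇(ζ ⋆ k_ε)(x) = ∫ k_ε(y) ∇ζ(y + x) dy` for Lipschitz `ζ` (Literature
`Torus.gradient_convolution_of_lipschitz`, translation invariance, evenness of `k_ε`). [folklore] -/
theorem gradient_convolution_kernel_eq (hζ : LipschitzWith K ζ) {ε : ℝ} (hε : 0 < ε)
    (hε' : ε ≤ 1 / 4) (x : UnitAddTorus d) :
    Torus.gradient (ζ ⋆ Torus.kernel ε) x =
      ∫ y, Torus.kernel ε y • Torus.gradient ζ (y + x) := by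
  rw [Torus.gradient_convolution_of_lipschitz hζ (Torus.isSmooth_kernel hε hε') x,
    ← integral_add_right_eq_self (fun y => Torus.kernel ε (x - y) • Torus.gradient ζ y) x]
  refine integral_congr_ae (Eventually.of_forall fun y => ?_)
  have e : x - (y + x) = -y := by abel
  simp only [e, Torus.kernel_neg hε hε']

omit [DecidableEq d] in
/-- `∫ ‖F‖² = (∫⁻ ‖F‖ₑ²).toReal` for a measurable field. [folklore, bookkeeping] -/
theorem integral_norm_sq_eq_lintegral_rpow_toReal {F : UnitAddTorus d → EuclideanSpace ℝ d}
    (hF : Measurable F) :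
    ∫ x, ‖F x‖ ^ 2 = (∫⁻ x, ‖F x‖ₑ ^ (2 : ℝ)).toReal := by
  rw [integral_eq_lintegral_of_nonneg_ae (Eventually.of_forall fun x => sq_nonneg _)
    (hF.norm.pow_const 2).aestronglyMeasurable]
  congr 1
  refine lintegral_congr fun x => ?_
  rw [← ofReal_norm, ENNReal.ofReal_rpow_of_nonneg (norm_nonneg _) (by norm_num), Real.rpow_two]

omit [DecidableEq d] in
/-- **Mollification does not increase the Dirichlet integral of a Lipschitz function**:
`∫ ‖∇(ζ ⋆ k_ε)‖² ≤ ∫ ‖∇ζ‖²` (Minkowski–Jensen for an average of translates, `∫ k_ε = 1`). [folklore] -/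
theorem integral_norm_sq_gradient_convolution_le (hζ : LipschitzWith K ζ) {ε : ℝ} (hε : 0 < ε)
    (hε' : ε ≤ 1 / 4) :
    ∫ x, ‖Torus.gradient (ζ ⋆ Torus.kernel ε) x‖ ^ 2 ≤ ∫ x, ‖Torus.gradient ζ x‖ ^ 2 := by
  set k : UnitAddTorus d → ℝ := Torus.kernel ε with hk
  set G : UnitAddTorus d → EuclideanSpace ℝ d := Torus.gradient ζ
  have hkc : Continuous k := Torus.continuous_kernel hε hε'
  have hknn : ∀ y, 0 ≤ k y := fun y => Torus.kernel_nonneg hε.le y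
  have hGm : Measurable G := Torus.measurable_gradient ζ
  have hk1 : ∫⁻ y, ‖k y‖ₑ = 1 := by
    have h1 : ∫⁻ y, ‖k y‖ₑ = ∫⁻ y, ENNReal.ofReal (k y) :=
      lintegral_congr fun y => by rw [Real.enorm_eq_ofReal (hknn y)]
    rw [h1, ← ofReal_integral_eq_lintegral_ofReal hkc.integrable_unitAddTorus
      (Eventually.of_forall hknn), hk, Torus.integral_kernel hε hε', ENNReal.ofReal_one]
  -- Minkowski–Jensen in `lintegral` form, for the average of translates of `G`
  set B : ℝ≥0∞ := ∫⁻ x, ‖G x‖ₑ ^ (2 : ℝ) with hB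
  have hΦ : AEStronglyMeasurable (uncurry fun x y : UnitAddTorus d => G (y + x))
      ((volume : Measure (UnitAddTorus d)).prod volume) :=
    (hGm.comp (measurable_snd.add measurable_fst)).aestronglyMeasurable
  have hBy : ∀ᵐ y ∂(volume : Measure (UnitAddTorus d)), k y ≠ 0 →
      ∫⁻ x, ‖G (y + x)‖ₑ ^ (2 : ℝ) ≤ B :=
    Eventually.of_forall fun y _ =>
      (lintegral_add_left_eq_self (fun x => ‖G x‖ₑ ^ (2 : ℝ)) y).le
  have hMJ := lintegral_rpow_enorm_integral_smul_le (μ := volume) (ν := volume)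
    hkc.aestronglyMeasurable hΦ (p := (2 : ℝ)) (by norm_num) hBy
  rw [hk1, ENNReal.one_rpow, one_mul] at hMJ
  have hBfin : B ≠ ⊤ := by
    refine ne_top_of_le_ne_top (b := ∫⁻ _ : UnitAddTorus d, (K : ℝ≥0∞) ^ (2 : ℝ)) ?_ ?_
    · rw [lintegral_const, measure_univ, mul_one]
      exact ENNReal.rpow_ne_top_of_nonneg (by norm_num) ENNReal.coe_ne_top
    · refine lintegral_mono fun x => ENNReal.rpow_le_rpow ?_ (by norm_num)
      rw [← ofReal_norm, ← ENNReal.ofReal_coe_nnreal]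
      exact ENNReal.ofReal_le_ofReal (Torus.norm_gradient_le_of_lipschitz hζ x)
  rw [integral_norm_sq_eq_lintegral_rpow_toReal (Torus.measurable_gradient _),
    integral_norm_sq_eq_lintegral_rpow_toReal hGm]
  refine ENNReal.toReal_mono hBfin ?_
  calc ∫⁻ x, ‖Torus.gradient (ζ ⋆ k) x‖ₑ ^ (2 : ℝ)
      = ∫⁻ x, ‖∫ y, k y • G (y + x)‖ₑ ^ (2 : ℝ) :=
        lintegral_congr fun x => by rw [gradient_convolution_kernel_eq hζ hε hε' x]
    _ ≤ B := hMJ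

end Mollify

/-! ## § 2 The Poincaré inequality for Lipschitz functions on `T³` -/

/-- **Poincaré inequality for Lipschitz functions on `T³`**: `4π² ∫ (ζ − ∫ζ)² ≤ ∫ ‖∇ζ‖²`,
`∇ζ = Torus.gradient ζ` the junk-valued (a.e. true, Rademacher) gradient — the treeʼs smooth
inequality for `ζ ⋆ k_ε`, § 1, and uniform convergence `ζ ⋆ k_ε → ζ`. [folklore; ours = assembly] -/
theorem four_pi_sq_mul_integral_sq_sub_mean_le_of_lipschitz {K : ℝ≥0}
    {ζ : UnitAddTorus (Fin 3) → ℝ} (hζ : LipschitzWith K ζ) :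
    4 * Real.pi ^ 2 * ∫ x, (ζ x - ∫ y, ζ y) ^ 2 ≤ ∫ x, ‖Torus.gradient ζ x‖ ^ 2 := by
  have hζc : Continuous ζ := hζ.continuous
  have hζi : Integrable ζ volume := hζc.integrable_unitAddTorus
  obtain ⟨B, hB⟩ := Torus.exists_forall_norm_le_of_continuous hζc
  have hB0 : 0 ≤ B := (norm_nonneg _).trans (hB 0)
  have hBx : ∀ x, |ζ x| ≤ B := fun x => Real.norm_eq_abs (ζ x) ▸ hB x
  set c : ℝ := ∫ y, ζ y with hc
  have hcB : |c| ≤ B := (abs_integral_le_integral_abs).trans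
    (by simpa using integral_mono hζi.abs (integrable_const B) hBx)
  refine le_of_forall_pos_le_add fun η hη => ?_
  set M : ℝ := 4 * Real.pi ^ 2 * (2 * (4 * B + 2)) with hM
  have hMpos : 0 < M := by have := Real.pi_pos; positivity
  set θ : ℝ := min 1 (η / M) with hθ
  have hθpos : 0 < θ := lt_min one_pos (div_pos hη hMpos)
  have hθ1 : θ ≤ 1 := min_le_left _ _
  have hθM : M * θ ≤ η :=
    (mul_le_mul_of_nonneg_left (min_le_right _ _) hMpos.le).trans_eq (mul_div_cancel₀ η hMpos.ne')
  obtain ⟨δ, hδ, hclose⟩ := Torus.exists_forall_dist_convolution_le hζc hθpos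
  set ε : ℝ := min (δ / 2) (1 / 4) with hεdef
  have hε : 0 < ε := lt_min (half_pos hδ) (by norm_num)
  have hε' : ε ≤ 1 / 4 := min_le_right _ _
  have hsupp : Function.support (Torus.kernel (d := Fin 3) ε) ⊆ ball 0 δ :=
    (Torus.support_kernel_subset hε).trans
      (Metric.ball_subset_ball ((min_le_left _ _).trans (half_le_self hδ.le)))
  set ζε : UnitAddTorus (Fin 3) → ℝ := ζ ⋆ Torus.kernel ε with hζε
  have hdist : ∀ z, |ζε z - ζ z| ≤ θ := fun z => by
    rw [← Real.dist_eq, hζε, ← Torus.convolution_comm_real (Torus.kernel ε) ζ]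
    exact hclose hsupp (fun w => Torus.kernel_nonneg hε.le w) (Torus.integral_kernel hε hε') z
  have hsm : Torus.IsSmooth ζε := Torus.isSmooth_convolution hζi (Torus.isSmooth_kernel hε hε')
  have hζεi : Integrable ζε volume := hsm.continuous.integrable_unitAddTorus
  -- the smooth Poincaré inequality for `ζε`, with `Σₖ (∂ₖ ζε)² = ‖∇ζε‖²`, and § 1
  have hP := four_pi_sq_mul_integral_sq_sub_mean_le hsm
  have hgrad : (fun x => ∑ k, (Torus.partialDeriv k ζε x) ^ 2) =
      fun x => ‖Torus.gradient ζε x‖ ^ 2 := by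
    funext x
    rw [EuclideanSpace.norm_sq_eq]
    refine Finset.sum_congr rfl fun k _ => ?_
    rw [Torus.gradient_apply (hsm.isContDiff (by simp)) x k, Real.norm_eq_abs, sq_abs]
  have hG : ∫ x, ∑ k, (Torus.partialDeriv k ζε x) ^ 2 ≤ ∫ x, ‖Torus.gradient ζ x‖ ^ 2 := by
    rw [hgrad]
    exact integral_norm_sq_gradient_convolution_le hζ hε hε'
  set cε : ℝ := ∫ y, ζε y with hcε
  have hcc : |cε - c| ≤ θ := by
    rw [hcε, hc, ← integral_sub hζεi hζi]
    exact (abs_integral_le_integral_abs).trans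
      (by simpa using integral_mono (hζεi.sub hζi).abs (integrable_const θ) hdist)
  have hpt : ∀ x, (ζ x - c) ^ 2 ≤ (ζε x - cε) ^ 2 + 2 * θ * (4 * B + 2) := by
    intro x
    obtain ⟨l1, r1⟩ := abs_le.1 (hdist x)
    obtain ⟨l2, r2⟩ := abs_le.1 (hBx x)
    obtain ⟨l3, r3⟩ := abs_le.1 hcB
    obtain ⟨l4, r4⟩ := abs_le.1 hcc
    -- `a² − b² = (a − b)(a + b)` with `|a − b| ≤ 2θ`, `|a + b| ≤ 4B + 2θ`, `θ² ≤ θ`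
    nlinarith [mul_nonneg (by linarith : (0 : ℝ) ≤ 2 * θ - ((ζ x - c) - (ζε x - cε)))
        (by linarith : (0 : ℝ) ≤ 4 * B + 2 * θ + ((ζ x - c) + (ζε x - cε))),
      mul_nonneg (by linarith : (0 : ℝ) ≤ 2 * θ + ((ζ x - c) - (ζε x - cε)))
        (by linarith : (0 : ℝ) ≤ 4 * B + 2 * θ - ((ζ x - c) + (ζε x - cε))),
      mul_nonneg hθpos.le (sub_nonneg.2 hθ1), mul_nonneg hθpos.le hB0]
  have hsqi : Integrable (fun x => (ζ x - c) ^ 2) volume :=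
    ((hζc.sub continuous_const).pow 2).integrable_unitAddTorus
  have hsqεi : Integrable (fun x => (ζε x - cε) ^ 2) volume :=
    ((hsm.continuous.sub continuous_const).pow 2).integrable_unitAddTorus
  have haddi : Integrable (fun x => (ζε x - cε) ^ 2 + 2 * θ * (4 * B + 2)) volume :=
    hsqεi.add (integrable_const _)
  have hint : ∫ x, (ζ x - c) ^ 2 ≤ (∫ x, (ζε x - cε) ^ 2) + 2 * θ * (4 * B + 2) := by
    have h := integral_mono hsqi haddi hpt
    rw [integral_add hsqεi (integrable_const _)] at h
    simpa using h
  calc 4 * Real.pi ^ 2 * ∫ x, (ζ x - c) ^ 2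
      ≤ 4 * Real.pi ^ 2 * ((∫ x, (ζε x - cε) ^ 2) + 2 * θ * (4 * B + 2)) :=
        mul_le_mul_of_nonneg_left hint (by positivity)
    _ = 4 * Real.pi ^ 2 * (∫ x, (ζε x - cε) ^ 2) + M * θ := by rw [hM]; ring
    _ ≤ (∫ x, ∑ k, (Torus.partialDeriv k ζε x) ^ 2) + η := add_le_add hP hθM
    _ ≤ (∫ x, ‖Torus.gradient ζ x‖ ^ 2) + η := add_le_add hG le_rfl

/-! ## § 3 A.e. calculus for the Lipschitz top strain eigenvalue (any `d`) -/

section AECalculus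

variable [Nonempty d] {v : UnitAddTorus d → EuclideanSpace ℝ d}

/-- At Rademacher points of `λ₁` (a.e.), `‖∇λ₁‖² = Σᵢ (∂ᵢλ₁)²`. [folklore] -/
theorem norm_sq_gradient_topEig_eq_ae (hv : Torus.IsSmooth v) :
    ∀ᵐ x ∂(volume : Measure (UnitAddTorus d)),
      ‖Torus.gradient (torusStrainTopEig v) x‖ ^ 2 =
        ∑ i, (Torus.partialDeriv i (torusStrainTopEig v) x) ^ 2 := by
  obtain ⟨K, hK⟩ := exists_lipschitzWith_torusStrainTopEig hv
  filter_upwards [Torus.ae_differentiableAt_liftAt hK] with x hx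
  rw [EuclideanSpace.norm_sq_eq]
  refine Finset.sum_congr rfl fun i _ => ?_
  rw [Real.norm_eq_abs, sq_abs, partialDeriv_topEig_eq hx i, ← Torus.inner_gradient_left,
    EuclideanSpace.inner_single_right]
  simp

/-- **A.e. chain rule**: `∇(λ₁^p) = p λ₁^{p−1} ∇λ₁` at Rademacher points of `λ₁` (`p ≥ 1`). [folklore] -/
theorem gradient_rpow_topEig_eq_ae (hv : Torus.IsSmooth v) {p : ℝ} (hp : 1 ≤ p) :
    ∀ᵐ x ∂(volume : Measure (UnitAddTorus d)),
      Torus.gradient (fun y => torusStrainTopEig v y ^ p) x =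
        (p * torusStrainTopEig v x ^ (p - 1)) • Torus.gradient (torusStrainTopEig v) x := by
  obtain ⟨K, hK⟩ := exists_lipschitzWith_torusStrainTopEig hv
  filter_upwards [Torus.ae_differentiableAt_liftAt hK] with x hx
  have h3 := (Real.hasDerivAt_rpow_const (p := p) (Or.inr hp)).comp_hasFDerivAt
    (0 : EuclideanSpace ℝ d) (Torus.hasFDerivAt_liftAt hx)
  rw [Torus.liftAt_apply_zero] at h3
  have h4 : Torus.fderiv (fun y => torusStrainTopEig v y ^ p) x =
      (p * torusStrainTopEig v x ^ (p - 1)) • Torus.fderiv (torusStrainTopEig v) x := h3.fderiv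
  rw [Torus.gradient_eq_toDual_symm_torusFderiv, Torus.gradient_eq_toDual_symm_torusFderiv, h4,
    map_smul]

/-- For divergence-free `v` and real `q ≥ 2`: `‖∇(λ₁^{q/2})‖² = (q²/4) λ₁^{q−2} Σᵢ (∂ᵢλ₁)²` a.e.
[ours, bookkeeping] -/
theorem norm_sq_gradient_rpow_topEig_eq_ae {q : ℝ} (hq : 2 ≤ q) (hv : Torus.IsSmooth v)
    (hdv : Torus.IsDivFree v) :
    ∀ᵐ x ∂(volume : Measure (UnitAddTorus d)),
      ‖Torus.gradient (fun y => torusStrainTopEig v y ^ (q / 2)) x‖ ^ 2 =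
        q ^ 2 / 4 * (torusStrainTopEig v x ^ (q - 2) *
          ∑ i, (Torus.partialDeriv i (torusStrainTopEig v) x) ^ 2) := by
  have hp : (1 : ℝ) ≤ q / 2 := by linarith
  filter_upwards [gradient_rpow_topEig_eq_ae hv hp, norm_sq_gradient_topEig_eq_ae hv]
    with x hx hx'
  have hL0 : 0 ≤ torusStrainTopEig v x := by
    rw [← lam_strainFlat]; exact lam_strainFlat_nonneg hv hdv x
  rw [hx, norm_smul, mul_pow, ← hx', Real.norm_eq_abs, sq_abs, mul_pow,
    ← Real.rpow_natCast (torusStrainTopEig v x ^ (q / 2 - 1)) 2, ← Real.rpow_mul hL0]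
  have e : (q / 2 - 1) * ((2 : ℕ) : ℝ) = q - 2 := by push_cast; ring
  rw [e]
  ring

/-- `λ₁^p` is Lipschitz (`p ≥ 1`, `div v = 0`: `λ₁` is Lipschitz, valued in `[0, M]`). [folklore] -/
theorem exists_lipschitzWith_rpow_topEig (hv : Torus.IsSmooth v) (hdv : Torus.IsDivFree v)
    {p : ℝ} (hp : 1 ≤ p) :
    ∃ C : ℝ≥0, LipschitzWith C (fun y => torusStrainTopEig v y ^ p) := by
  obtain ⟨K, hK⟩ := exists_lipschitzWith_torusStrainTopEig hv
  obtain ⟨M, hM⟩ := Torus.exists_forall_norm_le_of_continuous (continuous_torusStrainTopEig hv)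
  have hM0 : 0 ≤ M := (norm_nonneg _).trans (hM 0)
  have hLnn : ∀ x, 0 ≤ torusStrainTopEig v x := fun x => by
    rw [← lam_strainFlat]; exact lam_strainFlat_nonneg hv hdv x
  have hLM : ∀ x, torusStrainTopEig v x ≤ M := fun x =>
    (le_abs_self _).trans (Real.norm_eq_abs _ ▸ hM x)
  set L : ℝ := p * (M + 1) ^ (p - 1) with hL
  have hL0 : 0 ≤ L := mul_nonneg (by linarith) (Real.rpow_nonneg (by linarith) _)
  have hpow : LipschitzOnWith (Real.toNNReal L) (fun t : ℝ => t ^ p) (Icc 0 (M + 1)) := by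
    refine (convex_Icc 0 (M + 1)).lipschitzOnWith_of_nnnorm_hasDerivWithin_le
      (f' := fun t => p * t ^ (p - 1))
      (fun t _ => (Real.hasDerivAt_rpow_const (Or.inr hp)).hasDerivWithinAt) fun t ht => ?_
    rw [← NNReal.coe_le_coe, coe_nnnorm, Real.coe_toNNReal _ hL0, Real.norm_eq_abs,
      abs_of_nonneg (mul_nonneg (by linarith) (Real.rpow_nonneg ht.1 _)), hL]
    exact mul_le_mul_of_nonneg_left (Real.rpow_le_rpow ht.1 ht.2 (by linarith)) (by linarith)
  refine ⟨Real.toNNReal L * K, ?_⟩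
  have hmaps : MapsTo (torusStrainTopEig v) univ (Icc 0 (M + 1)) :=
    fun x _ => ⟨hLnn x, (hLM x).trans (by linarith)⟩
  exact lipschitzOnWith_univ.1 (hpow.comp hK.lipschitzOnWith hmaps)

end AECalculus

/-! ## § 4 The rate–variance rule on `T³` -/

section RateVariance

variable {v : UnitAddTorus (Fin 3) → EuclideanSpace ℝ (Fin 3)} {q : ℝ}

/-- **RATE–VARIANCE RULE (variance form).** For every real `q ≥ 2` and every smooth divergence-free
`v` on `T³`: `16π²(q−1)/q · ∫ (λ₁^{q/2} − ∫ λ₁^{q/2})² ≤ heatDissipation Φ_q v` — LEMMA AF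
`q(q−1)∫λ₁^{q−2}Σᵢ(∂ᵢλ₁)² ≤ heatDissipation Φ_q v`, `λ₁^{q−2}Σᵢ(∂ᵢλ₁)² = (4/q²)‖∇(λ₁^{q/2})‖²`
a.e. (§ 3) and the Lipschitz Poincaré inequality (§ 2). [ours] -/
theorem rate_variance_le_heatDissipation (hq : 2 ≤ q) (hv : Torus.IsSmooth v)
    (hdv : Torus.IsDivFree v) :
    16 * Real.pi ^ 2 * (q - 1) / q *
        ∫ x, (torusStrainTopEig v x ^ (q / 2) - ∫ y, torusStrainTopEig v y ^ (q / 2)) ^ 2 ≤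
      heatDissipation (torusTopEigMoment q) v := by
  obtain ⟨C, hC⟩ := exists_lipschitzWith_rpow_topEig hv hdv (p := q / 2) (by linarith)
  have hP := four_pi_sq_mul_integral_sq_sub_mean_le_of_lipschitz hC
  have hI : ∫ x, ‖Torus.gradient (fun y => torusStrainTopEig v y ^ (q / 2)) x‖ ^ 2 =
      q ^ 2 / 4 * ∫ x, torusStrainTopEig v x ^ (q - 2) *
        ∑ i, (Torus.partialDeriv i (torusStrainTopEig v) x) ^ 2 := by
    rw [← integral_const_mul]
    exact integral_congr_ae (norm_sq_gradient_rpow_topEig_eq_ae hq hv hdv)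
  have hF := topEigAmplitudeFloor_of_two_le (d := Fin 3) hq (Fintype.card_fin 3) v hv hdv
  set A : ℝ := ∫ x, torusStrainTopEig v x ^ (q - 2) *
    ∑ i, (Torus.partialDeriv i (torusStrainTopEig v) x) ^ 2 with hA
  set V : ℝ := ∫ x, (torusStrainTopEig v x ^ (q / 2) -
    ∫ y, torusStrainTopEig v y ^ (q / 2)) ^ 2 with hV
  calc 16 * Real.pi ^ 2 * (q - 1) / q * V
      = 4 * (q - 1) / q * (4 * Real.pi ^ 2 * V) := by ring
    _ ≤ 4 * (q - 1) / q * (q ^ 2 / 4 * A) :=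
        mul_le_mul_of_nonneg_left (hP.trans_eq hI) (div_nonneg (by linarith) (by linarith))
    _ = q * (q - 1) * A := by field_simp
    _ ≤ heatDissipation (torusTopEigMoment q) v := hF

/-- `∫ (λ₁^{q/2} − ∫λ₁^{q/2})² = Φ_q − Φ_{q/2}²` (`T³` has volume one; `λ₁ ≥ 0`). [bookkeeping] -/
theorem integral_sq_sub_mean_rpow_topEig_eq (hq : 0 ≤ q) (hv : Torus.IsSmooth v)
    (hdv : Torus.IsDivFree v) :
    ∫ x, (torusStrainTopEig v x ^ (q / 2) - ∫ y, torusStrainTopEig v y ^ (q / 2)) ^ 2 =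
      torusTopEigMoment q v - torusTopEigMoment (q / 2) v ^ 2 := by
  have hLnn : ∀ x, 0 ≤ torusStrainTopEig v x := fun x => by
    rw [← lam_strainFlat]; exact lam_strainFlat_nonneg hv hdv x
  have hΦ : ∀ p : ℝ, torusTopEigMoment p v = ∫ x, torusStrainTopEig v x ^ p := fun p => by
    unfold torusTopEigMoment
    exact integral_congr_ae (Eventually.of_forall fun x => by simp only [max_eq_left (hLnn x)])
  have hgc : Continuous fun x => torusStrainTopEig v x ^ (q / 2) :=
    (continuous_torusStrainTopEig hv).rpow_const fun x => Or.inr (by linarith)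
  have hgi : Integrable (fun x => torusStrainTopEig v x ^ (q / 2)) volume :=
    hgc.integrable_unitAddTorus
  have hg2i : Integrable (fun x => (torusStrainTopEig v x ^ (q / 2)) ^ 2) volume :=
    (hgc.pow 2).integrable_unitAddTorus
  have hg2 : ∀ x, (torusStrainTopEig v x ^ (q / 2)) ^ 2 = torusStrainTopEig v x ^ q := fun x => by
    rw [← Real.rpow_natCast, ← Real.rpow_mul (hLnn x)]
    norm_num
  set c : ℝ := ∫ y, torusStrainTopEig v y ^ (q / 2) with hc
  have e : ∀ x, (torusStrainTopEig v x ^ (q / 2) - c) ^ 2 =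
      ((torusStrainTopEig v x ^ (q / 2)) ^ 2 - 2 * c * torusStrainTopEig v x ^ (q / 2)) + c ^ 2 :=
    fun x => by ring
  have hsubi : Integrable (fun x => (torusStrainTopEig v x ^ (q / 2)) ^ 2 -
      2 * c * torusStrainTopEig v x ^ (q / 2)) volume := hg2i.sub (hgi.const_mul _)
  simp_rw [e]
  rw [integral_add hsubi (integrable_const _), integral_sub hg2i (hgi.const_mul _),
    integral_const_mul, hΦ q, hΦ (q / 2), ← hc]
  simp only [hg2, integral_const, smul_eq_mul, probReal_univ]
  ring

/-- **RATE–VARIANCE RULE (moment form).** For every real `q ≥ 2` and every smooth divergence-free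
`v` on `T³`: `16π²(q−1)/q · (Φ_q(v) − Φ_{q/2}(v)²) ≤ heatDissipation Φ_q v`. [ours] -/
theorem rate_moments_le_heatDissipation (hq : 2 ≤ q) (hv : Torus.IsSmooth v)
    (hdv : Torus.IsDivFree v) :
    16 * Real.pi ^ 2 * (q - 1) / q * (torusTopEigMoment q v - torusTopEigMoment (q / 2) v ^ 2) ≤
      heatDissipation (torusTopEigMoment q) v := by
  rw [← integral_sq_sub_mean_rpow_topEig_eq (by linarith) hv hdv]
  exact rate_variance_le_heatDissipation hq hv hdv

/-- **(R12) FLATTENING.** The moment deficit is paid for in heat: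
`Φ_q(v) − Φ_{q/2}(v)² ≤ q/(16π²(q−1)) · heatDissipation Φ_q v` (`q ≥ 2`); along a killing family
(`heatDissipation Φ_q v_n = o(Φ_q v_n)`) the ratio `Φ_{q/2}(v_n)²/Φ_q(v_n)` tends to `1`. [ours] -/
theorem moments_deficit_le (hq : 2 ≤ q) (hv : Torus.IsSmooth v) (hdv : Torus.IsDivFree v) :
    torusTopEigMoment q v - torusTopEigMoment (q / 2) v ^ 2 ≤
      q / (16 * Real.pi ^ 2 * (q - 1)) * heatDissipation (torusTopEigMoment q) v := by
  have h := rate_moments_le_heatDissipation hq hv hdv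
  have hq0 : 0 < q := by linarith
  have hq1 : 0 < q - 1 := by linarith
  have hc : 0 < 16 * Real.pi ^ 2 * (q - 1) / q := by positivity
  refine ((le_div_iff₀' hc).2 h).trans_eq ?_
  rw [div_div_eq_mul_div]
  ring

end RateVariance

end Variance

end TopEig

end Summit.NavierStokesRegularity.FunctionalMining
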